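import Mathlib.MeasureTheory.Constructions.BorelSpace.Metric
import Mathlib.Analysis.Convex.Topology
import Mathlib.Algebra.BigOperators.Fin
import Literature.NumberTheory.Transcendental.PeriodConjecture
import Literature.NumberTheory.Transcendental.SemialgebraicMapsProofs
import Literature.Computability.Complexity.ComputableRealProofs
import Literature.MeasureTheory.Lebesgue.PolynomialZeroSet
import HarnessLib

/-!
# Volumes of bounded semialgebraic sets are computable reals (Yoshinaga's theorem, effective part)

Yoshinaga [Yoshinaga 2008, arXiv:0805.0349, §3] proves that real Kontsevich–Zagier periods are
elementary (hence computable) real numbers in two steps: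

* (**reduction**, Lemma 24) the ring of periods is generated by the volumes `vol(D)` of *bounded*
  semialgebraic domains `D ⊆ ℝ^ℓ` — via the Belkale–Brosnan description of periods (Prop. 23) and
  Hironaka's rectilinearization (Prop. 22), i.e. resolution of singularities; Viu-Sos
  [Viu-Sos 2020, Thm. 1.1, Cor. 2.3] gives the sharper form `p = vol_d(K₁) − vol_d(K₂)` with
  `K₁, K₂` compact semialgebraic, again by resolution of singularities;
* (**effective approximation**, §§3.3–3.6) `vol(D)` is the limit of the Riemann sums
  `vol(V_n)`, `V_n` = the union of the grid cubes of mesh `r/n` contained in `D`; the test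
  "cube `⊆ D`" is a first-order condition on the cube's corners, decided by Tarski's quantifier
  elimination (Thm. 25), so `n ↦ vol(V_n)` is elementary (Lemma 26); and the rate
  `|vol(D) − vol(V_n)| < 1/k` for `n > 4 r L √ℓ k` (Lemma 29) comes from the finiteness of the
  `(ℓ−1)`-dimensional Minkowski content of `∂D` (Prop. 28, via uniformization Prop. 21).

This file proves the second step **for computability** (the tree's `IsComputableReal`: a
computable fast Cauchy name, Weihrauch 2000, Def. 4.1.13), for *every bounded `ℚ`-semialgebraic
set*, replacing the Minkowski-content rate of Lemma 29 (which needs uniformization) by a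
**two-sided squeeze**: with `lo_n = #(closed dyadic cubes ⊆ S)·2^{-nm}` and
`hi_n = #(closed dyadic cubes meeting S)·2^{-nm}` one has `lo_n ≤ vol S ≤ hi_n`, both sequences are
computable (the cube tests are membership of a rational parameter point in a `ℚ`-semialgebraic
subset of `ℝ^{m+1}`, by the Tarski–Seidenberg theorem proved in the tree,
`Literature.ModelTheory.ExponentialFields.tarski_seidenberg_real_holds`, and such membership is a
primitive recursive predicate of the parameters), and `hi_n − lo_n ≤ vol(N_{2⁻ⁿ}(∂S)) → vol(∂S) = 0`
because a cube counted in `hi_n` but not in `lo_n` meets `∂S` (cubes are connected), `∂S` lies in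
the zero set of a nonzero polynomial (induction over the Boolean algebra of semialgebraic sets) and
polynomial zero sets are Lebesgue-null (`MvPolynomial.volume_zeroSet_eq_zero`). No rate is needed:
the modulus is found by unbounded search (`IsComputableReal.of_twoSided`, Weihrauch 2000,
Lemma 4.2.1). This is the classical argument that Jordan-measurable sets with decidable cube tests
have computable volume; it yields computability, not Kalmár elementarity.

## Main statements

* `SemialgVolume.volume_frontier_eq_zero` — the frontier of a `ℚ`-semialgebraic set is null.
* `SemialgVolume.primrecPred_mem` — membership of a primitive recursive family of rational points in
  a fixed `ℚ`-semialgebraic subset of `ℝ^d` is a primitive recursive predicate.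
* `SemialgVolume.lo_le`, `SemialgVolume.le_hi`, `SemialgVolume.exists_hi_sub_lo_le` — the squeeze.
* `SemialgVolume.isComputableReal_volume` — **the volume of a bounded `ℚ`-semialgebraic subset of
  `ℝ^m` is a computable real**; `isComputableReal_volume_sub` — so are differences of two such.
* `isComputableReal_of_isRealPeriod_of_boundedReduction`,
  `isComputableComplex_of_isPeriod_of_boundedReduction` — Yoshinaga's computability statements
  (the named facts `isComputableReal_of_isRealPeriod`, `isComputableComplex_of_isPeriod` of
  `PeriodConjecture.lean`) follow from the bounded reduction of periods (Yoshinaga Lemma 24 /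
  Viu-Sos Cor. 2.3), taken as an explicit hypothesis: that reduction (resolution of singularities
  for the naive definition `IsRealPeriod`, which allows unbounded domains and integrands) is the
  only missing input and is deliberately NOT vendored here as a new named fact.

## References

* M. Yoshinaga, *Periods and elementary real numbers*, arXiv:0805.0349 (2008), §3 (Lemma 24,
  Thm. 25, Lemma 26, Prop. 28, Lemma 29).
* J. Viu-Sos, *A semi-canonical reduction for periods of Kontsevich–Zagier*, Int. J. Number Theory
  17 (2021), 147–174 (arXiv:1509.01097), Thm. 1.1, Cor. 2.3.
* K. Weihrauch, *Computable Analysis*, Springer (2000), Def. 4.1.13, Lemma 4.2.1.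
* J. Bochnak, M. Coste, M.-F. Roy, *Real Algebraic Geometry*, Springer (1998), Thm. 2.2.1.

## Design notes

* Dyadic meshes `2⁻ⁿ` keep the rational arithmetic inside the tree's primitive recursive kit for
  Mathlib's `Primcodable ℚ` (`rat_natDivTwoPow_primrec`, `rat_add/mul_primrec`, `rat_lt_primrecRel`
  of `ComputableRealProofs.lean`); grid cubes are indexed by `e < (r 2ⁿ)^m` through base-`r 2ⁿ`
  digits (`finFunctionFinEquiv`).
* No definitions of mathematical content are introduced besides the bookkeeping of the grid
  (`digit`, `corner`, `cbox`, `obox`, `innerCount`, `outerCount`, `lo`, `hi`, `paramBox`,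
  `innerParams`, `outerParams`, `boxParam`); no named facts.
-/

noncomputable section

open MeasureTheory Set Metric MvPolynomial Filter Topology
open scoped ENNReal
open Literature.ModelTheory.ExponentialFields

namespace Literature.NumberTheory.Transcendental

namespace SemialgVolume

variable {m : ℕ}

/-- Evaluation of a rational polynomial at a real point is evaluation of its image in `ℝ[X]`.
[folklore] -/
theorem aeval_eq_eval_map (p : MvPolynomial (Fin m) ℚ) (x : Fin m → ℝ) :
    aeval x p = eval x (map (algebraMap ℚ ℝ) p) := by
  rw [MvPolynomial.aeval_def, MvPolynomial.eval₂_eq_eval_map]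

/-- The frontier of a `ℚ`-semialgebraic subset of `ℝ ^ m` lies in the zero set of a nonzero real
polynomial: by induction over the generating Boolean algebra — `{p = 0}` is closed, `{p > 0}` is open
with closure inside `{p ≥ 0}`, frontiers of unions lie in the union of the frontiers (product of the
polynomials), and complements have the same frontier (cf. Yoshinaga 2008, proof of Lemma 29:
`∂D ⊆ {P = 0}`, `P = ∏ G_k`). [cite: Yoshinaga2008, Lemma 29 (proof)] -/
theorem exists_ne_zero_frontier_subset {S : Set (Fin m → ℝ)} (hS : IsSemialgebraic ℚ S) :
    ∃ q : MvPolynomial (Fin m) ℝ, q ≠ 0 ∧ frontier S ⊆ {x | eval x q = 0} := by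
  change S ∈ BooleanSubalgebra.closure _ at hS
  induction hS using BooleanSubalgebra.closure_bot_sup_induction with
  | mem s hs =>
    rcases hs with ⟨p, rfl⟩ | ⟨p, rfl⟩
    · show ∃ q : MvPolynomial (Fin m) ℝ, q ≠ 0 ∧ frontier {x : Fin m → ℝ | aeval x p = 0} ⊆ _
      by_cases hp : p = 0
      · refine ⟨1, one_ne_zero, ?_⟩
        have : {x : Fin m → ℝ | aeval x p = 0} = univ := by
          ext x; simp [hp]
        rw [this, frontier_univ]
        exact empty_subset _
      · refine ⟨map (algebraMap ℚ ℝ) p, ?_, ?_⟩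
        · simpa using (MvPolynomial.map_injective _ (algebraMap ℚ ℝ).injective).ne hp
        · have hcl : IsClosed {x : Fin m → ℝ | aeval x p = 0} := by
            have : {x : Fin m → ℝ | aeval x p = 0} =
                (fun x => eval x (map (algebraMap ℚ ℝ) p)) ⁻¹' {0} := by
              ext x; simp [aeval_eq_eval_map]
            rw [this]
            exact (isClosed_singleton).preimage (MvPolynomial.continuous_eval _)
          intro x hx
          have hx' := (hcl.frontier_subset) hx
          simpa [aeval_eq_eval_map] using hx'
    · show ∃ q : MvPolynomial (Fin m) ℝ, q ≠ 0 ∧ frontier {x : Fin m → ℝ | 0 < aeval x p} ⊆ _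
      by_cases hp : p = 0
      · refine ⟨1, one_ne_zero, ?_⟩
        have : {x : Fin m → ℝ | 0 < aeval x p} = ∅ := by
          ext x; simp [hp]
        rw [this, frontier_empty]
        exact empty_subset _
      · refine ⟨map (algebraMap ℚ ℝ) p, ?_, ?_⟩
        · simpa using (MvPolynomial.map_injective _ (algebraMap ℚ ℝ).injective).ne hp
        · have hcont : Continuous fun x : Fin m → ℝ => eval x (map (algebraMap ℚ ℝ) p) :=
            MvPolynomial.continuous_eval _
          have hop : IsOpen {x : Fin m → ℝ | 0 < aeval x p} := by
            have : {x : Fin m → ℝ | 0 < aeval x p} =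
                (fun x => eval x (map (algebraMap ℚ ℝ) p)) ⁻¹' Ioi 0 := by
              ext x; simp [aeval_eq_eval_map]
            rw [this]
            exact isOpen_Ioi.preimage hcont
          intro x hx
          rw [hop.frontier_eq] at hx
          obtain ⟨hx1, hx2⟩ := hx
          have hle : x ∈ {x : Fin m → ℝ | (0 : ℝ) ≤ eval x (map (algebraMap ℚ ℝ) p)} := by
            have hsub : closure {x : Fin m → ℝ | 0 < aeval x p} ⊆
                {x : Fin m → ℝ | (0 : ℝ) ≤ eval x (map (algebraMap ℚ ℝ) p)} := by
              have : {x : Fin m → ℝ | 0 < aeval x p} =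
                  {x : Fin m → ℝ | (0 : ℝ) < eval x (map (algebraMap ℚ ℝ) p)} := by
                ext x; simp [aeval_eq_eval_map]
              rw [this]
              exact closure_lt_subset_le continuous_const hcont
            exact hsub hx1
          have hnot : ¬ (0 : ℝ) < eval x (map (algebraMap ℚ ℝ) p) := by
            simpa [aeval_eq_eval_map] using hx2
          simp only [mem_setOf_eq] at hle ⊢
          exact le_antisymm (not_lt.1 hnot) hle
  | bot =>
    refine ⟨1, one_ne_zero, ?_⟩
    show frontier (∅ : Set (Fin m → ℝ)) ⊆ _
    rw [frontier_empty]
    exact empty_subset _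
  | sup s _ t _ ihs iht =>
    obtain ⟨q₁, hq₁, h₁⟩ := ihs
    obtain ⟨q₂, hq₂, h₂⟩ := iht
    refine ⟨q₁ * q₂, mul_ne_zero hq₁ hq₂, ?_⟩
    intro x hx
    have hx' : x ∈ frontier s ∪ frontier t := by
      have := frontier_union_subset s t hx
      rcases this with h | h
      · exact Or.inl h.1
      · exact Or.inr h.2
    simp only [mem_setOf_eq, map_mul, mul_eq_zero]
    rcases hx' with h | h
    · exact Or.inl (h₁ h)
    · exact Or.inr (h₂ h)
  | compl s _ ihs =>
    obtain ⟨q, hq, h⟩ := ihs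
    refine ⟨q, hq, ?_⟩
    show frontier sᶜ ⊆ _
    rw [frontier_compl]
    exact h

/-- The frontier of a `ℚ`-semialgebraic subset of `ℝ ^ m` is Lebesgue-null (it lies in the zero set
of a nonzero polynomial, `MvPolynomial.volume_zeroSet_eq_zero`). [folklore] -/
theorem volume_frontier_eq_zero {S : Set (Fin m → ℝ)} (hS : IsSemialgebraic ℚ S) :
    volume (frontier S) = 0 := by
  obtain ⟨q, hq, h⟩ := exists_ne_zero_frontier_subset hS
  exact measure_mono_null h (MvPolynomial.volume_zeroSet_eq_zero m q hq)


/-! ### Dyadic grid boxes -/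

/-- The `i`-th base-`B` digit of `e` (grid cubes are indexed by `e < B ^ m`). [folklore] -/
def digit (B e : ℕ) (i : Fin m) : ℕ := e / B ^ (i : ℕ) % B

/-- Digits are `< B`. [folklore] -/
theorem digit_lt {B e : ℕ} (hB : 0 < B) (i : Fin m) : digit B e i < B :=
  Nat.mod_lt _ hB

/-- Digits of `e < B ^ m` are the components of `finFunctionFinEquiv.symm e`. [folklore] -/
theorem digit_eq_finFunctionFinEquiv_symm {B e : ℕ} (he : e < B ^ m) (i : Fin m) :
    digit B e i = ((finFunctionFinEquiv.symm (⟨e, he⟩ : Fin (B ^ m))) i : ℕ) := by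
  rw [finFunctionFinEquiv_symm_apply_val]
  rfl

/-- Numbers below `B ^ m` with the same digits are equal. [folklore] -/
theorem eq_of_digit_eq {B e e' : ℕ} (he : e < B ^ m) (he' : e' < B ^ m)
    (h : ∀ i : Fin m, digit B e i = digit B e' i) : e = e' := by
  have : finFunctionFinEquiv.symm (⟨e, he⟩ : Fin (B ^ m)) =
      finFunctionFinEquiv.symm (⟨e', he'⟩ : Fin (B ^ m)) := by
    funext i
    apply Fin.ext
    rw [← digit_eq_finFunctionFinEquiv_symm he i, ← digit_eq_finFunctionFinEquiv_symm he' i]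
    exact h i
  have := finFunctionFinEquiv.symm.injective this
  simpa using congrArg Fin.val this

/-- Every digit vector below `B` is the digit vector of some `e < B ^ m`. [folklore] -/
theorem exists_digit_eq {B : ℕ} (k : Fin m → ℕ) (hk : ∀ i, k i < B) :
    ∃ e, e < B ^ m ∧ ∀ i, digit B e i = k i := by
  set f : Fin m → Fin B := fun i => ⟨k i, hk i⟩ with hf
  refine ⟨(finFunctionFinEquiv f : ℕ), (finFunctionFinEquiv f).isLt, fun i => ?_⟩
  have : digit B (finFunctionFinEquiv f : ℕ) i =
      ((finFunctionFinEquiv.symm (finFunctionFinEquiv f)) i : ℕ) := by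
    rw [digit_eq_finFunctionFinEquiv_symm (finFunctionFinEquiv f).isLt i, Fin.eta]
  rw [this, Equiv.symm_apply_apply]

/-- Lower corner `(digitᵢ(e) / 2ⁿ)ᵢ` of the `e`-th cube of the dyadic grid of mesh `2⁻ⁿ`
(Yoshinaga 2008, §3.4: the cubes `C_n(k₁, …, k_ℓ)`). [cite: Yoshinaga2008, §3.4] -/
def corner (B n e : ℕ) : Fin m → ℝ := fun i => (digit B e i : ℝ) / 2 ^ n

/-- The closed grid cube `∏ᵢ [kᵢ/2ⁿ, (kᵢ+1)/2ⁿ]` (Yoshinaga 2008, §3.4, `C_n(k)`), used for the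
logical tests "cube `⊆ S`", "cube meets `S`". [cite: Yoshinaga2008, §3.4] -/
def cbox (B n e : ℕ) : Set (Fin m → ℝ) :=
  Set.pi univ fun i => Icc (corner (m := m) B n e i) (corner (m := m) B n e i + 1 / 2 ^ n)

/-- The half-open grid cube `∏ᵢ [kᵢ/2ⁿ, (kᵢ+1)/2ⁿ)`, used for the volume bookkeeping (these are
pairwise disjoint and cover `[0, r)^m`). [folklore] -/
def obox (B n e : ℕ) : Set (Fin m → ℝ) :=
  Set.pi univ fun i => Ico (corner (m := m) B n e i) (corner (m := m) B n e i + 1 / 2 ^ n)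

/-- The half-open cube lies in the closed cube. [folklore] -/
theorem obox_subset_cbox (B n e : ℕ) : obox (m := m) B n e ⊆ cbox B n e :=
  Set.pi_mono fun _ _ => Ico_subset_Icc_self

/-- The corner belongs to the closed cube. [folklore] -/
theorem corner_mem_cbox (B n e : ℕ) : corner (m := m) B n e ∈ cbox B n e := by
  intro i _
  exact ⟨le_rfl, by simp only [le_add_iff_nonneg_right]; positivity⟩

/-- Closed cubes are nonempty. [folklore] -/
theorem cbox_nonempty (B n e : ℕ) : (cbox (m := m) B n e).Nonempty := ⟨_, corner_mem_cbox B n e⟩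

/-- Half-open cubes are measurable. [folklore] -/
theorem measurableSet_obox (B n e : ℕ) : MeasurableSet (obox (m := m) B n e) :=
  MeasurableSet.univ_pi fun _ => measurableSet_Ico

/-- A half-open cube of mesh `2⁻ⁿ` has volume `2^{-nm}`. [folklore] -/
theorem volume_obox (B n e : ℕ) :
    volume (obox (m := m) B n e) = ENNReal.ofReal ((1 / 2 ^ n) ^ m) := by
  rw [obox, Real.volume_pi_Ico]
  simp only [add_sub_cancel_left, Finset.prod_const, Finset.card_univ, Fintype.card_fin]
  rw [ENNReal.ofReal_pow (by positivity)]

/-- A point of a half-open grid cube determines the digits of the cube (`kᵢ = ⌊xᵢ 2ⁿ⌋`). [folklore] -/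
theorem digit_eq_floor_of_mem_obox {B n e : ℕ} {x : Fin m → ℝ} (hx : x ∈ obox (m := m) B n e)
    (i : Fin m) : digit B e i = ⌊x i * 2 ^ n⌋₊ := by
  have hi := hx i (mem_univ i)
  simp only [corner, mem_Ico] at hi
  obtain ⟨h1, h2⟩ := hi
  have hpos : (0 : ℝ) < 2 ^ n := by positivity
  symm
  rw [Nat.floor_eq_iff]
  · constructor
    · have := (div_le_iff₀ hpos).1 h1
      linarith
    · have h2' : x i < ((digit B e i : ℝ) + 1) / 2 ^ n := by
        rw [add_div]; exact h2
      have := (lt_div_iff₀ hpos).1 h2'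
      linarith
  · have : (0 : ℝ) ≤ (digit B e i : ℝ) / 2 ^ n := by positivity
    nlinarith

/-- Distinct half-open grid cubes are disjoint. [folklore] -/
theorem disjoint_obox {B n e e' : ℕ} (he : e < B ^ m) (he' : e' < B ^ m) (hne : e ≠ e') :
    Disjoint (obox (m := m) B n e) (obox B n e') := by
  rw [Set.disjoint_left]
  intro x hx hx'
  exact hne (eq_of_digit_eq he he' fun i =>
    (digit_eq_floor_of_mem_obox hx i).trans (digit_eq_floor_of_mem_obox hx' i).symm)

/-- Every point of `[0, r)^m` lies in some half-open cube of the grid with base `B = r 2ⁿ` digits.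
[folklore] -/
theorem exists_mem_obox {r n : ℕ} {x : Fin m → ℝ} (hx : x ∈ Set.pi univ fun _ => Ico (0 : ℝ) r) :
    ∃ e, e < (r * 2 ^ n) ^ m ∧ x ∈ obox (m := m) (r * 2 ^ n) n e := by
  have hpos : (0 : ℝ) < 2 ^ n := by positivity
  have hk : ∀ i, ⌊x i * 2 ^ n⌋₊ < r * 2 ^ n := by
    intro i
    obtain ⟨h0, hr⟩ := hx i (mem_univ i)
    rw [Nat.floor_lt (by positivity)]
    push_cast
    exact mul_lt_mul_of_pos_right hr hpos
  obtain ⟨e, he, hd⟩ := exists_digit_eq (fun i => ⌊x i * 2 ^ n⌋₊) hk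
  refine ⟨e, he, fun i _ => ?_⟩
  obtain ⟨h0, hr⟩ := hx i (mem_univ i)
  simp only [corner, hd, mem_Ico]
  have hfl := Nat.floor_le (mul_nonneg h0 hpos.le)
  have hlt := Nat.lt_floor_add_one (x i * 2 ^ n)
  constructor
  · rw [div_le_iff₀ hpos]; exact hfl
  · rw [← add_div, lt_div_iff₀ hpos]; exact hlt

/-- Two points of the same closed grid cube are within `2⁻ⁿ` of each other (sup metric).
[folklore] -/
theorem dist_le_of_mem_cbox {B n e : ℕ} {x y : Fin m → ℝ} (hx : x ∈ cbox (m := m) B n e)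
    (hy : y ∈ cbox (m := m) B n e) : dist x y ≤ 1 / 2 ^ n := by
  rw [dist_pi_le_iff (by positivity)]
  intro i
  obtain ⟨hx1, hx2⟩ := hx i (mem_univ i)
  obtain ⟨hy1, hy2⟩ := hy i (mem_univ i)
  rw [Real.dist_eq, abs_sub_le_iff]
  constructor <;> linarith

/-- Closed grid cubes are preconnected (they are convex). [folklore] -/
theorem isPreconnected_cbox (B n e : ℕ) : IsPreconnected (cbox (m := m) B n e) :=
  (convex_pi fun _ _ => convex_Icc _ _).isPreconnected

/-- A preconnected set meeting both `S` and its complement meets the frontier of `S` (else it would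
be covered by the disjoint open sets `interior S` and `(closure S)ᶜ`). [folklore] -/
theorem exists_mem_frontier_of_isPreconnected {X : Type*} [TopologicalSpace X] {C S : Set X}
    (hC : IsPreconnected C) {x y : X} (hx : x ∈ C) (hxS : x ∈ S) (hy : y ∈ C) (hyS : y ∉ S) :
    (C ∩ frontier S).Nonempty := by
  by_contra h
  rw [Set.not_nonempty_iff_eq_empty] at h
  have hsub : C ⊆ interior S ∪ (closure S)ᶜ := by
    intro z hz
    by_cases h1 : z ∈ closure S
    · left
      by_contra h2
      have : z ∈ C ∩ frontier S := ⟨hz, h1, h2⟩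
      rw [h] at this
      exact this
    · exact Or.inr h1
  rcases hC.subset_or_subset isOpen_interior isClosed_closure.isOpen_compl
      (Set.disjoint_left.2 fun z hz hz' => hz' (interior_subset_closure hz)) hsub with h' | h'
  · exact hyS (interior_subset (h' hy))
  · exact h' hx (subset_closure hxS)

/-! ### The two-sided Riemann-sum squeeze -/

open scoped Classical in
/-- Number of closed grid cubes of mesh `2⁻ⁿ` inside `[0, r]^m` that are contained in `S`
(Yoshinaga 2008, §3.4: the cubes making up `V_n`). [cite: Yoshinaga2008, §3.4] -/
def innerCount (S : Set (Fin m → ℝ)) (r n : ℕ) : ℕ :=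
  ((Finset.range ((r * 2 ^ n) ^ m)).filter fun e => cbox (m := m) (r * 2 ^ n) n e ⊆ S).card

open scoped Classical in
/-- Number of closed grid cubes of mesh `2⁻ⁿ` inside `[0, r]^m` that meet `S`. [folklore] -/
def outerCount (S : Set (Fin m → ℝ)) (r n : ℕ) : ℕ :=
  ((Finset.range ((r * 2 ^ n) ^ m)).filter fun e => (cbox (m := m) (r * 2 ^ n) n e ∩ S).Nonempty).card

/-- The inner Riemann sum `vol(V_n) = innerCount · 2^{-nm}` (Yoshinaga 2008, (eq. after Lemma 26)):
a rational lower bound for `vol S`. [cite: Yoshinaga2008, Lemma 26] -/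
def lo (S : Set (Fin m → ℝ)) (r n : ℕ) : ℚ := (innerCount S r n : ℚ) / 2 ^ (n * m)

/-- The outer Riemann sum `outerCount · 2^{-nm}`: a rational upper bound for `vol S`. [folklore] -/
def hi (S : Set (Fin m → ℝ)) (r n : ℕ) : ℚ := (outerCount S r n : ℚ) / 2 ^ (n * m)

/-- `c / 2^{nm} = c · (2⁻ⁿ)^m` in `ℝ`. [folklore] -/
theorem cast_card_div_eq (c n : ℕ) :
    (((c : ℚ) / 2 ^ (n * m) : ℚ) : ℝ) = (c : ℝ) * (1 / 2 ^ n) ^ m := by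
  push_cast
  rw [one_div_pow, ← pow_mul, div_eq_mul_one_div]

/-- Volume of a finite (disjoint) union of half-open grid cubes: count times `2^{-nm}`. [folklore] -/
theorem volume_biUnion_obox {B n : ℕ} (I : Finset ℕ) (hI : ∀ e ∈ I, e < B ^ m) :
    volume (⋃ e ∈ I, obox (m := m) B n e) = (I.card : ℝ≥0∞) * ENNReal.ofReal ((1 / 2 ^ n) ^ m) := by
  rw [measure_biUnion_finset]
  · simp only [volume_obox, Finset.sum_const, nsmul_eq_mul]
  · intro e he e' he' hne
    exact disjoint_obox (hI e he) (hI e' he') hne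
  · intro e _
    exact measurableSet_obox B n e

variable {S : Set (Fin m → ℝ)} {r : ℕ}

/-- Subsets of the box `[0, r)^m` have finite volume. [folklore] -/
theorem volume_lt_top_of_subset (hS : S ⊆ Set.pi univ fun _ => Ico (0 : ℝ) r) : volume S < ⊤ := by
  refine lt_of_le_of_lt (measure_mono hS) ?_
  rw [Real.volume_pi_Ico]
  simp

/-- **Lower bound** `vol(V_n) ≤ vol S`: the half-open cubes whose closures lie in `S` are disjoint
and contained in `S` (Yoshinaga 2008, §3.4, `V_n ⊆ D`). [cite: Yoshinaga2008, §3.4] -/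
theorem lo_le (hS : S ⊆ Set.pi univ fun _ => Ico (0 : ℝ) r) (n : ℕ) :
    ((lo S r n : ℚ) : ℝ) ≤ (volume S).toReal := by
  classical
  set I := (Finset.range ((r * 2 ^ n) ^ m)).filter fun e => cbox (m := m) (r * 2 ^ n) n e ⊆ S
    with hIdef
  have hI : ∀ e ∈ I, e < (r * 2 ^ n) ^ m := fun e he => Finset.mem_range.1 (Finset.mem_filter.1 he).1
  have hU : (⋃ e ∈ I, obox (m := m) (r * 2 ^ n) n e) ⊆ S := by
    intro x hx
    simp only [mem_iUnion, exists_prop] at hx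
    obtain ⟨e, he, hx⟩ := hx
    exact (Finset.mem_filter.1 he).2 (obox_subset_cbox _ _ _ hx)
  have h1 := volume_biUnion_obox (n := n) I hI
  have h2 : volume (⋃ e ∈ I, obox (m := m) (r * 2 ^ n) n e) ≤ volume S := measure_mono hU
  rw [h1] at h2
  have h3 := ENNReal.toReal_mono (volume_lt_top_of_subset hS).ne h2
  rw [ENNReal.toReal_mul, ENNReal.toReal_natCast, ENNReal.toReal_ofReal (by positivity)] at h3
  rw [lo, cast_card_div_eq]
  exact h3

/-- **Upper bound** `vol S ≤ hi_n`: `S ⊆ [0, r)^m` is covered by the half-open cubes whose closures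
meet `S`. [folklore] -/
theorem le_hi (hS : S ⊆ Set.pi univ fun _ => Ico (0 : ℝ) r) (n : ℕ) :
    (volume S).toReal ≤ ((hi S r n : ℚ) : ℝ) := by
  classical
  set J := (Finset.range ((r * 2 ^ n) ^ m)).filter
    fun e => (cbox (m := m) (r * 2 ^ n) n e ∩ S).Nonempty with hJdef
  have hJ : ∀ e ∈ J, e < (r * 2 ^ n) ^ m := fun e he => Finset.mem_range.1 (Finset.mem_filter.1 he).1
  have hU : S ⊆ ⋃ e ∈ J, obox (m := m) (r * 2 ^ n) n e := by
    intro x hx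
    obtain ⟨e, he, hxe⟩ := exists_mem_obox (n := n) (hS hx)
    simp only [mem_iUnion, exists_prop]
    exact ⟨e, Finset.mem_filter.2 ⟨Finset.mem_range.2 he, x, obox_subset_cbox _ _ _ hxe, hx⟩, hxe⟩
  have h1 := volume_biUnion_obox (n := n) J hJ
  have h2 : volume S ≤ volume (⋃ e ∈ J, obox (m := m) (r * 2 ^ n) n e) := measure_mono hU
  rw [h1] at h2
  have hfin : (J.card : ℝ≥0∞) * ENNReal.ofReal ((1 / 2 ^ n) ^ m) ≠ ⊤ :=
    ENNReal.mul_ne_top (ENNReal.natCast_ne_top _) ENNReal.ofReal_ne_top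
  have h3 := ENNReal.toReal_mono hfin h2
  rw [ENNReal.toReal_mul, ENNReal.toReal_natCast, ENNReal.toReal_ofReal (by positivity)] at h3
  rw [hi, cast_card_div_eq]
  exact h3

/-- **Gap estimate** `hi_n − lo_n ≤ vol(N_{2⁻ⁿ}(∂S))`: a closed cube meeting `S` but not contained
in `S` meets `∂S` (cubes are connected), so its half-open cube lies in the closed
`2⁻ⁿ`-neighbourhood of `∂S`; these half-open cubes are disjoint. (This replaces the
Minkowski-content bound `vol(D − D_{>ε}) < 2εL` of Yoshinaga 2008, Lemma 29, which gives a rate;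
none is claimed here.) [folklore] -/
theorem hi_sub_lo_le (n : ℕ) (hfin : volume (cthickening (1 / 2 ^ n) (frontier S)) ≠ ⊤) :
    ((hi S r n : ℚ) : ℝ) - lo S r n ≤ (volume (cthickening (1 / 2 ^ n) (frontier S))).toReal := by
  classical
  set B := r * 2 ^ n with hB
  set I := (Finset.range (B ^ m)).filter fun e => cbox (m := m) B n e ⊆ S with hIdef
  set J := (Finset.range (B ^ m)).filter fun e => (cbox (m := m) B n e ∩ S).Nonempty with hJdef
  have hIJ : I ⊆ J := by
    intro e he
    rw [Finset.mem_filter] at he ⊢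
    obtain ⟨x, hx⟩ := cbox_nonempty (m := m) B n e
    exact ⟨he.1, x, hx, he.2 hx⟩
  have hbad : ∀ e ∈ J \ I, obox (m := m) B n e ⊆ cthickening (1 / 2 ^ n) (frontier S) := by
    intro e he w hw
    rw [Finset.mem_sdiff, Finset.mem_filter, Finset.mem_filter, not_and] at he
    obtain ⟨⟨heB, x, hxC, hxS⟩, hnot⟩ := he
    have hnot' : ¬ cbox (m := m) B n e ⊆ S := hnot heB
    rw [Set.not_subset] at hnot'
    obtain ⟨y, hyC, hyS⟩ := hnot'
    obtain ⟨z, hzC, hzF⟩ :=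
      exists_mem_frontier_of_isPreconnected (isPreconnected_cbox B n e) hxC hxS hyC hyS
    exact Metric.mem_cthickening_of_dist_le w z _ _ hzF
      (dist_le_of_mem_cbox (obox_subset_cbox _ _ _ hw) hzC)
  have hJB : ∀ e ∈ J \ I, e < B ^ m := fun e he =>
    Finset.mem_range.1 (Finset.mem_filter.1 (Finset.mem_sdiff.1 he).1).1
  have hU : (⋃ e ∈ J \ I, obox (m := m) B n e) ⊆ cthickening (1 / 2 ^ n) (frontier S) := by
    intro w hw
    simp only [mem_iUnion, exists_prop] at hw
    obtain ⟨e, he, hw⟩ := hw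
    exact hbad e he hw
  have h1 := volume_biUnion_obox (n := n) (J \ I) hJB
  have h2 := measure_mono (μ := volume) hU
  rw [h1] at h2
  have h3 := ENNReal.toReal_mono hfin h2
  rw [ENNReal.toReal_mul, ENNReal.toReal_natCast, ENNReal.toReal_ofReal (by positivity),
    Finset.card_sdiff_of_subset hIJ, Nat.cast_sub (Finset.card_le_card hIJ)] at h3
  have : ((hi S r n : ℚ) : ℝ) - lo S r n = ((J.card : ℝ) - I.card) * (1 / 2 ^ n) ^ m := by
    rw [hi, lo, cast_card_div_eq, cast_card_div_eq]
    simp only [innerCount, outerCount, ← hB, ← hIdef, ← hJdef]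
    ring
  rw [this]
  exact h3

/-- **The gaps tend to `0`**: for every `p` some `hi_n − lo_n ≤ 2⁻ᵖ`, since
`vol(N_δ(∂S)) → vol(∂S) = 0` as `δ → 0` (`tendsto_measure_cthickening_of_isClosed`,
`volume_frontier_eq_zero`); no rate is claimed. [folklore] -/
theorem exists_hi_sub_lo_le (hSa : IsSemialgebraic ℚ S) (hS : S ⊆ Set.pi univ fun _ => Ico (0 : ℝ) r)
    (p : ℕ) : ∃ n, hi S r n - lo S r n ≤ 1 / (2 : ℚ) ^ p := by
  have hbdd : Bornology.IsBounded (frontier S) := by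
    have hb : Bornology.IsBounded (Set.pi univ fun _ : Fin m => Ico (0 : ℝ) r) :=
      Bornology.IsBounded.pi fun _ => Metric.isBounded_Ico _ _
    exact ((hb.closure).subset (frontier_subset_closure.trans (closure_mono hS)))
  have hfinR : ∀ R : ℝ, volume (cthickening R (frontier S)) ≠ ⊤ := fun R =>
    (hbdd.cthickening).measure_lt_top.ne
  have ht : Tendsto (fun δ => volume (cthickening δ (frontier S))) (𝓝 0) (𝓝 0) := by
    have := tendsto_measure_cthickening_of_isClosed (μ := volume) (s := frontier S)
      ⟨1, one_pos, hfinR 1⟩ isClosed_frontier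
    rwa [volume_frontier_eq_zero hSa] at this
  have hε : (0 : ℝ≥0∞) < ENNReal.ofReal (1 / 2 ^ p) := by
    rw [ENNReal.ofReal_pos]; positivity
  have hev := (ENNReal.tendsto_nhds_zero.1 ht) _ hε
  rw [Metric.eventually_nhds_iff] at hev
  obtain ⟨δ, hδ, hδ'⟩ := hev
  obtain ⟨n, hn⟩ := exists_pow_lt_of_lt_one hδ (by norm_num : (1 / 2 : ℝ) < 1)
  refine ⟨n, ?_⟩
  have hn' : dist (1 / (2 : ℝ) ^ n) 0 < δ := by
    rw [Real.dist_eq, sub_zero, abs_of_pos (by positivity), one_div_pow] at *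
    simpa [one_div] using hn
  have hle := hδ' hn'
  have hgap := hi_sub_lo_le (S := S) (r := r) n (hfinR _)
  have hreal : (volume (cthickening (1 / 2 ^ n) (frontier S))).toReal ≤ 1 / 2 ^ p := by
    have := ENNReal.toReal_mono ENNReal.ofReal_ne_top hle
    rwa [ENNReal.toReal_ofReal (by positivity)] at this
  have : (((hi S r n - lo S r n : ℚ)) : ℝ) ≤ ((1 / (2 : ℚ) ^ p : ℚ) : ℝ) := by
    push_cast
    linarith
  exact_mod_cast this


/-! ### The box tests are semialgebraic conditions on the box parameters -/

/-- The closed box with lower corner `(v₀, …, v_{m-1})` and side `v_m`, as a function of the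
parameter vector `v ∈ ℝ^{m+1}` (Yoshinaga 2008, §3.3: the boxes `∏ [sᵢ, tᵢ]` of the predicate `R`).
[cite: Yoshinaga2008, §3.3] -/
def paramBox (v : Fin (m + 1) → ℝ) : Set (Fin m → ℝ) :=
  Set.pi univ fun i => Icc (v (Fin.castSucc i)) (v (Fin.castSucc i) + v (Fin.last m))

/-- Grid cubes are parameter boxes with parameters `(corner, 2⁻ⁿ)`. [folklore] -/
theorem cbox_eq_paramBox (B n e : ℕ) :
    cbox (m := m) B n e = paramBox (Fin.snoc (corner (m := m) B n e) (1 / 2 ^ n)) := by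
  simp only [cbox, paramBox, Fin.snoc_castSucc, Fin.snoc_last]

/-- The set of parameters `v` whose box is contained in `S` (Yoshinaga 2008, §3.3, the predicate
`R(sᵢ, tᵢ)`: `∏ [sᵢ, tᵢ] ⊆ D`). [cite: Yoshinaga2008, §3.3] -/
def innerParams (S : Set (Fin m → ℝ)) : Set (Fin (m + 1) → ℝ) := {v | paramBox v ⊆ S}

/-- The set of parameters `v` whose box meets `S`. [folklore] -/
def outerParams (S : Set (Fin m → ℝ)) : Set (Fin (m + 1) → ℝ) := {v | (paramBox v ∩ S).Nonempty}

/-- The incidence set `{(v, x) | x ∈ box(v)} ⊆ ℝ ^ ((m + 1) + m)` is `ℚ`-semialgebraic (finitely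
many linear inequalities). [folklore] -/
theorem isSemialgebraic_setOf_mem_paramBox :
    IsSemialgebraic ℚ {w : Fin ((m + 1) + m) → ℝ |
      (w ∘ Fin.natAdd (m + 1)) ∈ paramBox (m := m) (w ∘ Fin.castAdd m)} := by
  have h : {w : Fin ((m + 1) + m) → ℝ | (w ∘ Fin.natAdd (m + 1)) ∈ paramBox (m := m) (w ∘ Fin.castAdd m)} =
      ⋂ i ∈ (Finset.univ : Finset (Fin m)),
        ({w : Fin ((m + 1) + m) → ℝ |
            aeval w (X (Fin.castAdd m (Fin.castSucc i)) : MvPolynomial (Fin ((m + 1) + m)) ℚ) ≤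
              aeval w (X (Fin.natAdd (m + 1) i) : MvPolynomial (Fin ((m + 1) + m)) ℚ)} ∩
          {w : Fin ((m + 1) + m) → ℝ |
            aeval w (X (Fin.natAdd (m + 1) i) : MvPolynomial (Fin ((m + 1) + m)) ℚ) ≤
              aeval w (X (Fin.castAdd m (Fin.castSucc i)) + X (Fin.castAdd m (Fin.last m)) :
                MvPolynomial (Fin ((m + 1) + m)) ℚ)}) := by
    ext w
    simp only [paramBox, mem_setOf_eq, Set.mem_pi, mem_univ, true_implies, Function.comp_apply,
      mem_Icc, mem_iInter, Finset.mem_univ, mem_inter_iff, aeval_X, map_add]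
  rw [h]
  exact IsSemialgebraic.biInter _ _ fun i _ =>
    (isSemialgebraic_setOf_eval_le _ _).inter (isSemialgebraic_setOf_eval_le _ _)

/-- **"Box meets `S`" is a semialgebraic condition on the parameters**: `outerParams S` is the
projection of `{(v, x) | x ∈ box(v), x ∈ S}` (Tarski–Seidenberg, `IsSemialgebraic.image_comp`).
[cite: BochnakCosteRoy1998, Thm. 2.2.1] -/
theorem isSemialgebraic_outerParams (hS : IsSemialgebraic ℚ S) :
    IsSemialgebraic ℚ (outerParams S) := by
  have hW : IsSemialgebraic ℚ ({w : Fin ((m + 1) + m) → ℝ |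
      (w ∘ Fin.natAdd (m + 1)) ∈ paramBox (m := m) (w ∘ Fin.castAdd m)} ∩
        ((fun w : Fin ((m + 1) + m) → ℝ => w ∘ Fin.natAdd (m + 1)) ⁻¹' S)) :=
    isSemialgebraic_setOf_mem_paramBox.inter (hS.preimage_comp _)
  convert hW.image_comp (Fin.castAdd m) using 1
  ext v
  simp only [outerParams, mem_setOf_eq, mem_image, mem_inter_iff, mem_preimage]
  constructor
  · rintro ⟨x, hxb, hxS⟩
    refine ⟨Fin.append v x, ⟨?_, ?_⟩, ?_⟩
    · have h1 : (Fin.append v x ∘ Fin.natAdd (m + 1)) = x := funext fun i => by simp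
      have h2 : (Fin.append v x ∘ Fin.castAdd m) = v := funext fun i => by simp
      rw [h1, h2]; exact hxb
    · have h1 : (Fin.append v x ∘ Fin.natAdd (m + 1)) = x := funext fun i => by simp
      rw [h1]; exact hxS
    · exact funext fun i => by simp
  · rintro ⟨w, ⟨hwb, hwS⟩, rfl⟩
    exact ⟨_, hwb, hwS⟩

/-- **"Box `⊆ S`" is a semialgebraic condition on the parameters** (Yoshinaga 2008, §3.3: by
Tarski's quantifier elimination, Thm. 25, the predicate `R` is equivalent to a quantifier-free
`R*`): `innerParams S` is the complement of the projection of `{(v, x) | x ∈ box(v), x ∉ S}`.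
[cite: Yoshinaga2008, §3.3 (Thm. 25)] -/
theorem isSemialgebraic_innerParams (hS : IsSemialgebraic ℚ S) :
    IsSemialgebraic ℚ (innerParams S) := by
  have hW : IsSemialgebraic ℚ ({w : Fin ((m + 1) + m) → ℝ |
      (w ∘ Fin.natAdd (m + 1)) ∈ paramBox (m := m) (w ∘ Fin.castAdd m)} ∩
        ((fun w : Fin ((m + 1) + m) → ℝ => w ∘ Fin.natAdd (m + 1)) ⁻¹' S)ᶜ) :=
    isSemialgebraic_setOf_mem_paramBox.inter (hS.preimage_comp _).compl
  convert (hW.image_comp (Fin.castAdd m)).compl using 1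
  refine Set.ext fun v => ⟨fun hv hv' => ?_, fun hv => ?_⟩
  · obtain ⟨w, ⟨hwb, hwS⟩, hwv⟩ := hv'
    have hv1 : paramBox v ⊆ S := hv
    have hwb' : (w ∘ Fin.natAdd (m + 1)) ∈ paramBox (m := m) (w ∘ Fin.castAdd m) := hwb
    have hwv' : (w ∘ Fin.castAdd m) = v := hwv
    rw [hwv'] at hwb'
    exact hwS (hv1 hwb')
  · intro x hxb
    by_contra hxS
    have h1 : (Fin.append v x ∘ Fin.natAdd (m + 1)) = x := funext fun i => by simp
    have h2 : (Fin.append v x ∘ Fin.castAdd m) = v := funext fun i => by simp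
    refine hv ⟨Fin.append v x, ⟨?_, ?_⟩, h2⟩
    · show (Fin.append v x ∘ Fin.natAdd (m + 1)) ∈ paramBox (m := m) (Fin.append v x ∘ Fin.castAdd m)
      rw [h1, h2]; exact hxb
    · show ¬ (Fin.append v x ∘ Fin.natAdd (m + 1)) ∈ S
      rw [h1]; exact hxS

/-! ### Membership of rational points in semialgebraic sets is primitive recursive -/

/-- Rational polynomials evaluated at rational points, cast to `ℝ`. [folklore] -/
theorem aeval_ratCast {d : ℕ} (v : Fin d → ℚ) (p : MvPolynomial (Fin d) ℚ) :
    aeval (fun i => (v i : ℝ)) p = ((eval v p : ℚ) : ℝ) := by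
  induction p using MvPolynomial.induction_on with
  | C c => simp
  | add p q hp hq => simp [hp, hq]
  | mul_X p i hp => simp [hp]

open Literature.Computability.Complexity in
/-- Evaluating a fixed rational polynomial along a primitive recursive family of rational points is
primitive recursive (induction on the polynomial; `rat_add_primrec`, `rat_mul_primrec`). [folklore] -/
theorem primrec_eval {α : Type*} [Primcodable α] {d : ℕ} {π : α → Fin d → ℚ}
    (hπ : ∀ i, Primrec fun a => π a i) (p : MvPolynomial (Fin d) ℚ) :
    Primrec fun a => eval (π a) p := by
  induction p using MvPolynomial.induction_on with
  | C c => simpa using Primrec.const c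
  | add p q hp hq => simpa using rat_add_primrec.comp hp hq
  | mul_X p i hp => simpa using rat_mul_primrec.comp hp (hπ i)

open Literature.Computability.Complexity in
/-- **Rational points of a `ℚ`-semialgebraic set are recognised primitive recursively**: along any
primitive recursive family of rational points, membership in a fixed `ℚ`-semialgebraic subset of
`ℝ ^ d` is a primitive recursive predicate (a fixed Boolean combination of sign conditions on
finitely many rational polynomials, evaluated in `ℚ`; Yoshinaga 2008, proof of Lemma 26: "the truth
value … is decided by checking the truth values of Boolean combination of predicates of the form
`p(kᵢr/n, (kᵢ+1)r/n, a_{kJ}) > 0`"). [cite: Yoshinaga2008, Lemma 26] -/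
theorem primrecPred_mem {α : Type*} [Primcodable α] {d : ℕ} {G : Set (Fin d → ℝ)}
    (hG : IsSemialgebraic ℚ G) {π : α → Fin d → ℚ} (hπ : ∀ i, Primrec fun a => π a i) :
    PrimrecPred fun a => (fun i => (π a i : ℝ)) ∈ G := by
  change G ∈ BooleanSubalgebra.closure _ at hG
  induction hG using BooleanSubalgebra.closure_bot_sup_induction with
  | mem s hs =>
    rcases hs with ⟨p, rfl⟩ | ⟨p, rfl⟩
    · refine (Primrec.eq.comp (primrec_eval hπ p) (Primrec.const 0)).of_eq fun a => ?_
      simp only [mem_setOf_eq, aeval_ratCast, Rat.cast_eq_zero]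
    · refine (rat_lt_primrecRel.comp (Primrec.const 0) (primrec_eval hπ p)).of_eq fun a => ?_
      simp only [mem_setOf_eq, aeval_ratCast, Rat.cast_pos]
  | bot =>
    refine (Primrec.eq.comp (Primrec.const (1 : ℕ)) (Primrec.const 0)).of_eq fun a => ?_
    simp only [Nat.one_ne_zero, false_iff]
    exact fun h => h
  | sup s _ t _ ihs iht =>
    exact (ihs.or iht).of_eq fun a => by simp only [Set.sup_eq_union, mem_union]
  | compl s _ ihs =>
    exact ihs.not.of_eq fun a => by simp only [mem_compl_iff]

/-! ### The Riemann sums are computable -/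

/-- The rational parameter vector `(corner, 2⁻ⁿ) ∈ ℚ^{m+1}` of the `e`-th grid cube of mesh `2⁻ⁿ`,
as a function of `(n, e)`. [folklore] -/
def boxParam (r : ℕ) (q : ℕ × ℕ) : Fin (m + 1) → ℚ :=
  Fin.snoc (fun i => (digit (m := m) (r * 2 ^ q.1) q.2 i : ℚ) / 2 ^ q.1) (1 / 2 ^ q.1)

/-- Cast to `ℝ`, the rational parameter vector is `(corner, 2⁻ⁿ)`. [folklore] -/
theorem cast_boxParam (r : ℕ) (q : ℕ × ℕ) :
    (fun i => (boxParam (m := m) r q i : ℝ)) =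
      Fin.snoc (corner (m := m) (r * 2 ^ q.1) q.1 q.2) (1 / 2 ^ q.1) := by
  funext i
  refine Fin.lastCases ?_ (fun j => ?_) i
  · simp [boxParam]
  · simp [boxParam, corner]

open Literature.Computability.Complexity in
/-- Each coordinate of the parameter vector is a primitive recursive function of `(n, e)` (digits by
`div`/`mod`, dyadic rationals by `rat_natDivTwoPow_primrec`). [folklore] -/
theorem primrec_boxParam (r : ℕ) (i : Fin (m + 1)) :
    Primrec fun q : ℕ × ℕ => boxParam (m := m) r q i := by
  have hpow : Primrec₂ ((· ^ ·) : ℕ → ℕ → ℕ) := Primrec₂.unpaired'.1 Nat.Primrec.pow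
  have hB : Primrec fun q : ℕ × ℕ => r * 2 ^ q.1 :=
    Primrec.nat_mul.comp (Primrec.const r) (hpow.comp (Primrec.const 2) Primrec.fst)
  refine Fin.lastCases ?_ (fun j => ?_) i
  · simp only [boxParam, Fin.snoc_last]
    simpa using rat_natDivTwoPow_primrec.comp (Primrec.const 1) Primrec.fst
  · simp only [boxParam, Fin.snoc_castSucc]
    have hd : Primrec fun q : ℕ × ℕ => digit (m := m) (r * 2 ^ q.1) q.2 j := by
      unfold digit
      exact Primrec.nat_mod.comp
        (Primrec.nat_div.comp Primrec.snd (hpow.comp hB (Primrec.const (j : ℕ)))) hB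
    exact rat_natDivTwoPow_primrec.comp hd Primrec.fst

/-- Counting by `Finset.filter` over `range K` is counting by `List.filter` over `List.range K`.
[folklore] -/
theorem card_filter_range_eq_length (K : ℕ) (P : ℕ → Prop) [DecidablePred P] :
    ((Finset.range K).filter P).card = ((List.range K).filter fun e => decide (P e)).length := by
  induction K with
  | zero => simp
  | succ K ih =>
    rw [Finset.range_add_one, Finset.filter_insert, List.range_succ, List.filter_append,
      List.length_append]
    by_cases hK : P K
    · rw [if_pos hK, Finset.card_insert_of_notMem (by simp), ih]
      simp [hK]
    · rw [if_neg hK, ih]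
      simp [hK]

open Literature.Computability.Complexity in
/-- A count of the grid cubes `e < (r 2ⁿ)^m` selected by a primitive recursive test on `(n, e)` is a
primitive recursive function of `n` (Yoshinaga 2008, Lemma 26: `vol(V_n)` is an elementary — here:
primitive recursive — function of `n`). [cite: Yoshinaga2008, Lemma 26] -/
theorem primrec_count (r : ℕ) {P : ℕ × ℕ → Prop} (hP : PrimrecPred P) :
    Primrec fun n : ℕ =>
      ((List.range ((r * 2 ^ n) ^ m)).filter fun e => @decide (P (n, e)) (Classical.dec _)).length := by
  classical
  have hpow : Primrec₂ ((· ^ ·) : ℕ → ℕ → ℕ) := Primrec₂.unpaired'.1 Nat.Primrec.pow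
  have hK : Primrec fun n : ℕ => (r * 2 ^ n) ^ m :=
    hpow.comp (Primrec.nat_mul.comp (Primrec.const r) (hpow.comp (Primrec.const 2) Primrec.id))
      (Primrec.const m)
  have hL : Primrec fun n : ℕ => (List.range ((r * 2 ^ n) ^ m)).map fun e => (n, e) :=
    Primrec.list_map (Primrec.list_range.comp hK) (Primrec.pair Primrec.fst Primrec.snd)
  have hF := (Primrec.list_length.comp ((Primrec.listFilter hP).comp hL))
  refine hF.of_eq fun n => ?_
  simp only [List.filter_map, List.length_map]
  congr 1

open Literature.Computability.Complexity in
/-- `n ↦ innerCount S r n` is primitive recursive (Yoshinaga 2008, Lemma 26).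
[cite: Yoshinaga2008, Lemma 26] -/
theorem primrec_innerCount (hS : IsSemialgebraic ℚ S) (r : ℕ) :
    Primrec fun n => innerCount S r n := by
  classical
  have hP : PrimrecPred fun q : ℕ × ℕ => (fun i => (boxParam (m := m) r q i : ℝ)) ∈ innerParams S :=
    primrecPred_mem (isSemialgebraic_innerParams hS) (primrec_boxParam r)
  refine (primrec_count (m := m) r hP).of_eq fun n => ?_
  rw [innerCount, card_filter_range_eq_length]
  congr 1
  apply List.filter_congr
  intro e _
  rw [decide_eq_decide]
  simp only [cast_boxParam, innerParams, mem_setOf_eq, cbox_eq_paramBox]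

open Literature.Computability.Complexity in
/-- `n ↦ outerCount S r n` is primitive recursive. [folklore] -/
theorem primrec_outerCount (hS : IsSemialgebraic ℚ S) (r : ℕ) :
    Primrec fun n => outerCount S r n := by
  classical
  have hP : PrimrecPred fun q : ℕ × ℕ => (fun i => (boxParam (m := m) r q i : ℝ)) ∈ outerParams S :=
    primrecPred_mem (isSemialgebraic_outerParams hS) (primrec_boxParam r)
  refine (primrec_count (m := m) r hP).of_eq fun n => ?_
  rw [outerCount, card_filter_range_eq_length]
  congr 1
  apply List.filter_congr
  intro e _
  rw [decide_eq_decide]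
  simp only [cast_boxParam, outerParams, mem_setOf_eq, cbox_eq_paramBox]

open Literature.Computability.Complexity in
/-- The inner Riemann sums form a computable sequence of rationals (Yoshinaga 2008, Lemma 26).
[cite: Yoshinaga2008, Lemma 26] -/
theorem computable_lo (hS : IsSemialgebraic ℚ S) (r : ℕ) : Computable (lo S r) :=
  ((rat_natDivTwoPow_primrec.comp (primrec_innerCount hS r)
    (Primrec.nat_mul.comp Primrec.id (Primrec.const m))).of_eq fun _ => rfl).to_comp

open Literature.Computability.Complexity in
/-- The outer Riemann sums form a computable sequence of rationals. [folklore] -/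
theorem computable_hi (hS : IsSemialgebraic ℚ S) (r : ℕ) : Computable (hi S r) :=
  ((rat_natDivTwoPow_primrec.comp (primrec_outerCount hS r)
    (Primrec.nat_mul.comp Primrec.id (Primrec.const m))).of_eq fun _ => rfl).to_comp

/-! ### Main results -/

open Literature.Computability.Complexity in
/-- **Volumes of `ℚ`-semialgebraic subsets of a box `[0, r)^m` are computable reals**: two-sided
squeeze `lo_n ≤ vol S ≤ hi_n` by computable rational sequences with gaps tending to `0`
(`IsComputableReal.of_twoSided`). Computable-real form of Yoshinaga 2008, §§3.3–3.6 (there: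
elementary, with the rate of Lemma 29). [cite: Yoshinaga2008, §3.6 (Lemma 26, Lemma 29)] -/
theorem isComputableReal_volume_of_subset (hSa : IsSemialgebraic ℚ S)
    (hS : S ⊆ Set.pi univ fun _ => Ico (0 : ℝ) r) : IsComputableReal (volume S).toReal :=
  IsComputableReal.of_twoSided (lo S r) (hi S r) (computable_lo hSa r) (computable_hi hSa r)
    (lo_le hS) (le_hi hS) (exists_hi_sub_lo_le hSa hS)


open Literature.Computability.Complexity in
/-- **The volume of a bounded `ℚ`-semialgebraic subset of `ℝ ^ m` is a computable real** (translate
into a box `[0, 2R)^m` by an integer vector: semialgebraicity and Lebesgue measure are translation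
invariant). Computable-real form of Yoshinaga 2008, §3 ("`vol(D)` is an elementary real number" for
bounded semialgebraic `D`). [cite: Yoshinaga2008, §3.6] -/
theorem isComputableReal_volume (hSa : IsSemialgebraic ℚ S) (hb : Bornology.IsBounded S) :
    IsComputableReal (volume S).toReal := by
  obtain ⟨ρ, hρ⟩ := hb.subset_closedBall (0 : Fin m → ℝ)
  set R : ℕ := ⌈ρ⌉₊ + 1 with hR
  have hρR : ρ < R := by
    rw [hR]; push_cast
    exact lt_of_le_of_lt (Nat.le_ceil ρ) (lt_add_one _)
  set S' : Set (Fin m → ℝ) := (fun y : Fin m → ℝ => fun i => y i - (R : ℝ)) ⁻¹' S with hS'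
  have hS'a : IsSemialgebraic ℚ S' := by
    convert hSa.preimage_aeval (fun i : Fin m => (X i - C (R : ℚ) : MvPolynomial (Fin m) ℚ)) using 1
    ext y
    simp [hS']
  have hsub : S' ⊆ Set.pi univ fun _ => Ico (0 : ℝ) ((2 * R : ℕ) : ℝ) := by
    intro y hy i _
    have hx : (fun i => y i - (R : ℝ)) ∈ closedBall (0 : Fin m → ℝ) ρ := hρ hy
    rw [mem_closedBall, dist_zero_right] at hx
    have hi : |y i - R| ≤ ρ := by
      have := norm_le_pi_norm (fun i => y i - (R : ℝ)) i
      rw [Real.norm_eq_abs] at this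
      exact this.trans hx
    rw [abs_le] at hi
    push_cast
    constructor <;> linarith [hi.1, hi.2]
  have hvol : volume S' = volume S := by
    have : S' = (fun y : Fin m → ℝ => (fun _ => -(R : ℝ)) + y) ⁻¹' S := by
      ext y
      simp only [hS', mem_preimage]
      congr! 1
      funext i
      simp [sub_eq_neg_add]
    rw [this, measure_preimage_add]
  have := isComputableReal_volume_of_subset hS'a hsub
  rwa [hvol] at this

open Literature.Computability.Complexity in
/-- Differences of volumes of bounded `ℚ`-semialgebraic sets are computable reals (computable reals
are a ring, `IsComputableReal.sub`). [folklore] -/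
theorem isComputableReal_volume_sub {d : ℕ} {K₁ K₂ : Set (Fin d → ℝ)} (h₁ : IsSemialgebraic ℚ K₁)
    (h₂ : IsSemialgebraic ℚ K₂) (hb₁ : Bornology.IsBounded K₁) (hb₂ : Bornology.IsBounded K₂) :
    IsComputableReal ((volume K₁).toReal - (volume K₂).toReal) :=
  (isComputableReal_volume h₁ hb₁).sub (isComputableReal_volume h₂ hb₂)

end SemialgVolume

/-! ### Yoshinaga's computability statements, reduced to the bounded-volume form of periods -/

open Literature.Computability.Complexity in
/-- **Real periods are computable, granted the reduction of periods to bounded volumes.** If every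
real period is a difference of volumes of two bounded `ℚ`-semialgebraic sets (Yoshinaga's Lemma 24
"`P` is generated by the volumes of bounded basic open semialgebraic sets"; Viu-Sos, Cor. 2.3:
`p = vol_d(K₁) − vol_d(K₂)` with `K₁, K₂` compact semialgebraic — both via resolution of
singularities), then every real period is a computable real (`SemialgVolume.isComputableReal_volume`).
The hypothesis is stated for the tree's naive `IsRealPeriod` with `ℚ`-semialgebraic bounded sets
(Viu-Sos' `K₁, K₂` are compact and defined over real algebraic numbers, hence `ℚ`-semialgebraic).
[cite: Yoshinaga2008, Thm. 18 with Lemma 24] -/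
theorem isComputableReal_of_isRealPeriod_of_boundedReduction
    (H : ∀ x : ℝ, IsRealPeriod x → ∃ (d : ℕ) (K₁ K₂ : Set (Fin d → ℝ)),
      IsSemialgebraic ℚ K₁ ∧ IsSemialgebraic ℚ K₂ ∧ Bornology.IsBounded K₁ ∧ Bornology.IsBounded K₂ ∧
        x = (volume K₁).toReal - (volume K₂).toReal) :
    isComputableReal_of_isRealPeriod := by
  intro x hx
  obtain ⟨d, K₁, K₂, h₁, h₂, hb₁, hb₂, rfl⟩ := H x hx
  exact SemialgVolume.isComputableReal_volume_sub h₁ h₂ hb₁ hb₂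

/-- **Periods are computable complex numbers, granted the reduction of periods to bounded volumes**
(the complex form of the previous theorem: a period has real-period real and imaginary parts, and
a complex number is computable iff both parts are; cf.
`isComputableComplex_of_isPeriod_of_isComputableReal` in `PeriodConjectureProofs.lean`).
[cite: Yoshinaga2008, Thm. 18 complex form] -/
theorem isComputableComplex_of_isPeriod_of_boundedReduction
    (H : ∀ x : ℝ, IsRealPeriod x → ∃ (d : ℕ) (K₁ K₂ : Set (Fin d → ℝ)),
      IsSemialgebraic ℚ K₁ ∧ IsSemialgebraic ℚ K₂ ∧ Bornology.IsBounded K₁ ∧ Bornology.IsBounded K₂ ∧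
        x = (volume K₁).toReal - (volume K₂).toReal) :
    isComputableComplex_of_isPeriod := by
  intro z hz
  exact ⟨isComputableReal_of_isRealPeriod_of_boundedReduction H hz.1,
    isComputableReal_of_isRealPeriod_of_boundedReduction H hz.2⟩

end Literature.NumberTheory.Transcendental
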